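import Literature.Analysis.InnerProduct.GramHadamard
import Mathlib.Analysis.InnerProductSpace.PiL2
import HarnessLib

/-!
# The determinant (Gram) bound for translation-covariant fermionic propagators

Trunk **QLatticeAQFT**; programme under `HubbardFermiLiquid.bgm_two_point_limit`.  The convergence
of fermionic perturbation theory rests on the absence of the `n!` in the bound of the `2n`-point
Gaussian expectation `|𝓔(ψ⁻_{x₁}⋯ψ⁻_{xₙ}ψ⁺_{y₁}⋯ψ⁺_{yₙ})| = |det G|`, `G_{ij} = g(xᵢ - yⱼ)`
(Mastropietro 2008, §2.7, (2.63)–(2.78); Benfatto–Giuliani–Mastropietro 2006, §2.8): writing the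
propagator as an inner product `g(x - y) = (A(x - ·), B(y - ·))` (2.65)/(2.76), Gram's inequality
(Lemma 2.2, (2.66); `Literature/Analysis/InnerProduct/GramHadamard.lean`) gives
`|det G| ≤ ∏ ‖A(xᵢ - ·)‖‖B(yᵢ - ·)‖ ≤ C₀^{2n}` (2.77)–(2.78).  This file proves the bound for the
finite-volume, momentum-space form of a translation-covariant propagator,
`G(x,y) = Σ_k χ(x,k) conj χ(y,k) ĝ(k)` (`momentumKernel`; for the free lattice propagator
`χ(x,k) = e^{ikx}/√|Λ|`, `ĝ` the Fourier transform, BGM (1.4)/(2.4)):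

* `norm_det_momentumKernel_le` — if `‖χ(x,k)‖ ≤ 1` then
  `‖det [G(xₐ, y_b)]_{a,b ≤ n}‖ ≤ (Σ_k ‖ĝ(k)‖)ⁿ` for all `n`, `x`, `y`.

Helpers: `sqrt_norm_mul_div_sqrt_norm`, `norm_div_sqrt_norm_le` (the splitting `ĝ = conj(α)β`,
`|α|² = |β|² = |ĝ|`).  All proved; the only definition is `momentumKernel`.

## Sources

V. Mastropietro, *Non-Perturbative Renormalization* (World Scientific, 2008), Ch. 2 §2.7, PDF
pp. 42–43 of the held copy `book:mastropietro2008-non-perturbative-renormalization`: (2.64)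
`𝓔(ψ⁻_{x₁}⋯ψ⁺_{yₙ}) = det G`, (2.65) `g(x-y) = ∫dz A(x-z)B̄(y-z)`, Lemma 2.2 (2.66)
`|det H| ≤ ∏ ‖fⱼ‖‖gⱼ‖` for `H_{ij} = (fᵢ, gⱼ)`, (2.76)–(2.77)
`|𝓔(ψ⁻_{x₁}⋯ψ⁺_{yₙ})| ≤ ∏ⱼ ‖A(xᵢ - ·)‖ ‖B(xᵢ - ·)‖`, (2.78) `≤ C₀^{2n}`; bib key `Mastropietro2008`.
G. Benfatto, A. Giuliani, V. Mastropietro, Ann. Henri Poincaré 7 (2006), §2.8 (Gram–Hadamard bounds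
for the kernels of the tree expansion); bib key `BenfattoGiulianiMastropietro2006`.
-/

noncomputable section

open Finset Matrix
open scoped InnerProductSpace ComplexConjugate

namespace Literature.MathematicalPhysics.QuantumLattice

variable {K : Type*} [Fintype K] {X : Type*}

/-- The **momentum-space propagator kernel** `G(x, y) = Σ_k χ(x,k) conj(χ(y,k)) ĝ(k)` of a
"covariance" `ĝ` on a finite momentum set, with "plane waves" `χ` (e.g. `χ(x,k) = e^{ik·x}/√|Λ|`,
the free propagator `g(x - y) = |Λ|⁻¹ Σ_k e^{ik(x-y)} ĝ(k)` of BGM 2006, (1.4)/(2.4); the convolution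
form `g(x-y) = ∫dz A(x-z) B̄(y-z)` of Mastropietro 2008, (2.65), in Fourier space). [folklore] -/
def momentumKernel (χ : X → K → ℂ) (ĝ : K → ℂ) (x y : X) : ℂ :=
  ∑ k, χ x k * conj (χ y k) * ĝ k

/-- The square-root splitting of the covariance: `ĝ = conj(α) β` with `|α|² = |β|² = |ĝ|`.
[folklore] -/
theorem sqrt_norm_mul_div_sqrt_norm (z : ℂ) :
    ((Real.sqrt ‖z‖ : ℝ) : ℂ) * (z / (Real.sqrt ‖z‖ : ℝ)) = z := by
  by_cases hz : z = 0
  · simp [hz]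
  · have h : ((Real.sqrt ‖z‖ : ℝ) : ℂ) ≠ 0 := by
      rw [Ne, Complex.ofReal_eq_zero, Real.sqrt_eq_zero (norm_nonneg z), norm_eq_zero]
      exact hz
    field_simp

/-- `|z/√|z|| ≤ √|z|` (with the junk value `0` at `z = 0`). [folklore] -/
theorem norm_div_sqrt_norm_le (z : ℂ) : ‖z / ((Real.sqrt ‖z‖ : ℝ) : ℂ)‖ ≤ Real.sqrt ‖z‖ := by
  by_cases hz : z = 0
  · simp [hz]
  · have hpos : 0 < ‖z‖ := norm_pos_iff.2 hz
    rw [norm_div, Complex.norm_real, Real.norm_of_nonneg (Real.sqrt_nonneg _),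
      div_le_iff₀ (Real.sqrt_pos.2 hpos), Real.mul_self_sqrt hpos.le]

/-- **The determinant (Gram) bound for translation-covariant propagators** (Mastropietro 2008,
(2.64)–(2.78): writing `g(xᵢ - yⱼ) = (A(xᵢ - ·), B(yⱼ - ·))` as inner products, Lemma 2.2 (Gram's
inequality (2.66)) gives `|𝓔(ψ⁻_{x₁}⋯ψ⁺_{yₙ})| = |det G| ≤ ∏ ‖A‖‖B‖ ≤ C₀^{2n}` — no `n!`; this is the
bound behind the convergence of fermionic perturbation theory, Benfatto–Giuliani–Mastropietro
2006, §2.8).  Here in Fourier form: if `‖χ(x,k)‖ ≤ 1` for all `x, k`, then for every `n` and all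
`x, y : Fin n → X`,
`‖det [G(xₐ, y_b)]_{a,b}‖ ≤ (Σ_k ‖ĝ(k)‖)ⁿ`, `G = momentumKernel χ ĝ`.  Proof: `G(x,y) = ⟪u_x, v_y⟫` in
`ℓ²(K)` with `u_x(k) = conj χ(x,k) √|ĝ(k)|`, `v_y(k) = conj χ(y,k) ĝ(k)/√|ĝ(k)|`,
`‖u_x‖², ‖v_y‖² ≤ Σ|ĝ|`, and `Literature.Analysis.InnerProduct.norm_det_inner_le_prod_norm_mul_prod_norm`.
[cite: Mastropietro2008, Ch. 2 (2.77)] -/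
theorem norm_det_momentumKernel_le (χ : X → K → ℂ) (hχ : ∀ x k, ‖χ x k‖ ≤ 1) (ĝ : K → ℂ)
    {n : ℕ} (x y : Fin n → X) :
    ‖(Matrix.of fun a b => momentumKernel χ ĝ (x a) (y b)).det‖ ≤ (∑ k, ‖ĝ k‖) ^ n := by
  -- the Gram vectors
  let u : Fin n → EuclideanSpace ℂ K := fun a =>
    WithLp.toLp 2 fun k => conj (χ (x a) k) * ((Real.sqrt ‖ĝ k‖ : ℝ) : ℂ)
  let v : Fin n → EuclideanSpace ℂ K := fun b =>
    WithLp.toLp 2 fun k => conj (χ (y b) k) * (ĝ k / ((Real.sqrt ‖ĝ k‖ : ℝ) : ℂ))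
  have hinner : ∀ a b, ⟪u a, v b⟫_ℂ = momentumKernel χ ĝ (x a) (y b) := by
    intro a b
    rw [PiLp.inner_apply, momentumKernel]
    refine Finset.sum_congr rfl fun k _ => ?_
    simp only [u, v, RCLike.inner_apply, map_mul, Complex.conj_conj, Complex.conj_ofReal]
    calc conj (χ (y b) k) * (ĝ k / ((Real.sqrt ‖ĝ k‖ : ℝ) : ℂ)) * (χ (x a) k * ((Real.sqrt ‖ĝ k‖ : ℝ) : ℂ))
        = χ (x a) k * conj (χ (y b) k) * (((Real.sqrt ‖ĝ k‖ : ℝ) : ℂ) * (ĝ k / ((Real.sqrt ‖ĝ k‖ : ℝ) : ℂ))) := by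
          ring
      _ = χ (x a) k * conj (χ (y b) k) * ĝ k := by rw [sqrt_norm_mul_div_sqrt_norm]
  -- norms of the Gram vectors
  have hS : 0 ≤ ∑ k, ‖ĝ k‖ := Finset.sum_nonneg fun _ _ => norm_nonneg _
  have hu : ∀ a, ‖u a‖ ≤ Real.sqrt (∑ k, ‖ĝ k‖) := by
    intro a
    rw [← Real.sqrt_sq (norm_nonneg (u a)), EuclideanSpace.norm_sq_eq]
    refine Real.sqrt_le_sqrt (Finset.sum_le_sum fun k _ => ?_)
    simp only [u]
    rw [norm_mul, RCLike.norm_conj, Complex.norm_real, Real.norm_of_nonneg (Real.sqrt_nonneg _), mul_pow,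
      Real.sq_sqrt (norm_nonneg _)]
    calc ‖χ (x a) k‖ ^ 2 * ‖ĝ k‖ ≤ 1 ^ 2 * ‖ĝ k‖ := by
          gcongr
          exact hχ _ _
      _ = ‖ĝ k‖ := by rw [one_pow, one_mul]
  have hv : ∀ b, ‖v b‖ ≤ Real.sqrt (∑ k, ‖ĝ k‖) := by
    intro b
    rw [← Real.sqrt_sq (norm_nonneg (v b)), EuclideanSpace.norm_sq_eq]
    refine Real.sqrt_le_sqrt (Finset.sum_le_sum fun k _ => ?_)
    simp only [v]
    rw [norm_mul, RCLike.norm_conj, mul_pow]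
    calc ‖χ (y b) k‖ ^ 2 * ‖ĝ k / ((Real.sqrt ‖ĝ k‖ : ℝ) : ℂ)‖ ^ 2 ≤ 1 ^ 2 * (Real.sqrt ‖ĝ k‖) ^ 2 := by
          gcongr
          · exact hχ _ _
          · exact norm_div_sqrt_norm_le _
      _ = ‖ĝ k‖ := by rw [one_pow, one_mul, Real.sq_sqrt (norm_nonneg _)]
  -- Gram–Hadamard
  have hM : (Matrix.of fun a b => momentumKernel χ ĝ (x a) (y b)) = Matrix.of fun a b => ⟪u a, v b⟫_ℂ := by
    ext a b; rw [Matrix.of_apply, Matrix.of_apply, hinner]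
  rw [hM]
  refine (Literature.Analysis.InnerProduct.norm_det_inner_le_prod_norm_mul_prod_norm u v).trans ?_
  have h1 : ∏ a, ‖u a‖ ≤ Real.sqrt (∑ k, ‖ĝ k‖) ^ n := by
    calc ∏ a, ‖u a‖ ≤ ∏ _a : Fin n, Real.sqrt (∑ k, ‖ĝ k‖) :=
          Finset.prod_le_prod (fun _ _ => norm_nonneg _) fun a _ => hu a
      _ = Real.sqrt (∑ k, ‖ĝ k‖) ^ n := by rw [Finset.prod_const, Finset.card_univ, Fintype.card_fin]
  have h2 : ∏ b, ‖v b‖ ≤ Real.sqrt (∑ k, ‖ĝ k‖) ^ n := by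
    calc ∏ b, ‖v b‖ ≤ ∏ _b : Fin n, Real.sqrt (∑ k, ‖ĝ k‖) :=
          Finset.prod_le_prod (fun _ _ => norm_nonneg _) fun b _ => hv b
      _ = Real.sqrt (∑ k, ‖ĝ k‖) ^ n := by rw [Finset.prod_const, Finset.card_univ, Fintype.card_fin]
  calc (∏ a, ‖u a‖) * ∏ b, ‖v b‖ ≤ Real.sqrt (∑ k, ‖ĝ k‖) ^ n * Real.sqrt (∑ k, ‖ĝ k‖) ^ n :=
        mul_le_mul h1 h2 (Finset.prod_nonneg fun _ _ => norm_nonneg _) (pow_nonneg (Real.sqrt_nonneg _) _)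
    _ = (∑ k, ‖ĝ k‖) ^ n := by rw [← mul_pow, Real.mul_self_sqrt hS]

end Literature.MathematicalPhysics.QuantumLattice
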